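import Summits.AtomisticToContinuum.Crystallization.Theses.GrainCoreNetworkSplit
import Summits.AtomisticToContinuum.Crystallization.Theorems.PalmUnimodularRigidityMinimiserShellsEquilibriumInLaw
import Summits.AtomisticToContinuum.Crystallization.Theorems.PalmUnimodularRigidityUnimodularEnergyLowerBound
import Literature.Probability.Process.PointStationaryLaw
import Literature.MathematicalPhysics.StatisticalMechanics.RootEnergy

/-!
# GrainCoreNetworkSplit · MuEquilibriumDoor — CLOSER (decomp-a2c lens 2, g15)

`muEquilibriumDoor` closes the support item `…Theses.GrainCoreNetworkSplit.MuEquilibriumDoor` BY NAME (the route file is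
import-neutral, critic row 236 BC11/BC12, so this file may import the `MuGSC.lean` side).  Below, the original note:

`muEquilibriumDoor_holds` : the support item `GrainCoreNetworkSplit.MuEquilibriumDoor` BY SIGNATURE (name-free μGSC
text = the body of `Literature…MuGroundStateConfiguration.IsMuGSC`, so that this file — which must import the
`MuGSC.lean` side of the library through `EquilibriumInLaw` and therefore cannot be co-imported with the lens-2 route
files (duplicate declaration `Literature…UniformlyDiscrete` in MuGSC.lean / MuGroundStateConfiguration.lean) — proves
exactly the item's text).  Inputs: tree `EquilibriumInLaw.stub_equilibriumInLaw` (Aug 17) and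
`unimodularEnergyLowerBound_proof` (item 9229).  FARM: the EquilibriumInLaw chain was rebuilt 2026-08-31T08:22Z
(gate13 BUILT line on the decomp-a2c INBOX, operator kick at hand-1 g8's / writer-1's request); landed by hand-1 g8.  Target:
`Summits/AtomisticToContinuum/Crystallization/Theorems/GrainCoreNetworkSplitMuEquilibriumDoor.lean`.
-/

noncomputable section

open MeasureTheory

namespace Summit.AtomisticToContinuum.Crystallization.Theorems.GrainCoreNetworkSplitMuEquilibriumDoor

open Literature.MathematicalPhysics.StatisticalMechanics (isMuGSC_iff fieldEnergy_eq)

/-- The μ-equilibrium door, by signature. [tree: stub_equilibriumInLaw, unimodularEnergyLowerBound_proof] -/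
theorem muEquilibriumDoor_holds :
    ∀ δ : ℝ, 0 < δ → ∀ P : MeasureTheory.Measure (MeasureTheory.Measure (EuclideanSpace ℝ (Fin 3))), MeasureTheory.IsProbabilityMeasure P → (∀ᵐ μ ∂P, Literature.Probability.Process.IsRootedHardCore δ μ) → Literature.Probability.Process.IsPointStationaryLaw P → (∫ μ, Literature.MathematicalPhysics.StatisticalMechanics.rootEnergy Literature.MathematicalPhysics.StatisticalMechanics.lennardJones μ ∂P) ≤ (⨅ Q : Literature.MathematicalPhysics.StatisticalMechanics.PeriodicConfiguration 3, Q.energyPerParticle Literature.MathematicalPhysics.StatisticalMechanics.lennardJones) → ∀ᵐ μ ∂P, ((∀ r : EuclideanSpace ℝ (Fin 3), Summable fun y : ↥({p : EuclideanSpace ℝ (Fin 3) | μ {p} ≠ 0}) => Literature.MathematicalPhysics.StatisticalMechanics.lennardJones (dist r y)) ∧ ∀ (n : ℕ) (xf : Fin n → EuclideanSpace ℝ (Fin 3)), Function.Injective xf → Set.range xf ⊆ {p : EuclideanSpace ℝ (Fin 3) | μ {p} ≠ 0} → ∀ (k : ℕ) (R : Fin k → EuclideanSpace ℝ (Fin 3)),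 Function.Injective R → Disjoint (Set.range R) ({p : EuclideanSpace ℝ (Fin 3) | μ {p} ≠ 0} \ Set.range xf) → Literature.MathematicalPhysics.StatisticalMechanics.interactionEnergy Literature.MathematicalPhysics.StatisticalMechanics.lennardJones xf + (∑ i, ∑' y : ↥({p : EuclideanSpace ℝ (Fin 3) | μ {p} ≠ 0} \ Set.range xf), Literature.MathematicalPhysics.StatisticalMechanics.lennardJones (dist (xf i) y)) - (⨅ Q : Literature.MathematicalPhysics.StatisticalMechanics.PeriodicConfiguration 3, Q.energyPerParticle Literature.MathematicalPhysics.StatisticalMechanics.lennardJones) * n ≤ Literature.MathematicalPhysics.StatisticalMechanics.interactionEnergy Literature.MathematicalPhysics.StatisticalMechanics.lennardJones R + (∑ i, ∑' y : ↥({p : EuclideanSpace ℝ (Fin 3) | μ {p} ≠ 0} \ Set.range xf), Literature.MathematicalPhysics.StatisticalMechanics.lennardJones (dist (R i) y)) - (⨅ Q : Literature.MathematicalPhysics.StatisticalMechanics.PeriodicConfiguration 3, Q.energyPerParticle Literature.MathematicalPhysics.StatisticalMechanics.lennardJones) * k) := by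
  intro δ hδ P hP hcore hstat hE
  have h :=
    Summit.AtomisticToContinuum.Crystallization.Theorems.PalmUnimodularRigidityMinimiserShells.EquilibriumInLaw.stub_equilibriumInLaw
      Summit.AtomisticToContinuum.Crystallization.Theorems.unimodularEnergyLowerBound_proof δ hδ P hP hcore hstat
      (by
        simpa [Summit.AtomisticToContinuum.Crystallization.Theorems.MinimiserShells.Negative.LoadBearing.meanRootEnergy,
          Summit.AtomisticToContinuum.Crystallization.Theorems.MinimiserShells.Negative.LoadBearing.eStar,
          Literature.MathematicalPhysics.StatisticalMechanics.rootEnergy] using hE)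
  filter_upwards [h] with μ hμ
  obtain ⟨S, rfl, hS⟩ := hμ
  have hsing : ∀ p : EuclideanSpace ℝ (Fin 3),
      ((Measure.count : Measure (EuclideanSpace ℝ (Fin 3))).restrict S) {p} ≠ 0 ↔ p ∈ S :=
    Literature.Probability.Process.count_restrict_singleton_ne_zero_iff S
  have hset : {p : EuclideanSpace ℝ (Fin 3) |
      ((Measure.count : Measure (EuclideanSpace ℝ (Fin 3))).restrict S) {p} ≠ 0} = S := by
    ext p; exact hsing p
  have h2 := (isMuGSC_iff _ _ _).mp hS
  refine ⟨fun r => ?_, fun n xf hxf hX k R hR hdisj => ?_⟩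
  · exact (Equiv.summable_iff (Equiv.setCongr hset)).2 (h2.1 r)
  · have hX' : Set.range xf ⊆ S := fun x hx => (hsing x).1 (hX hx)
    have hAS : {p : EuclideanSpace ℝ (Fin 3) |
        ((Measure.count : Measure (EuclideanSpace ℝ (Fin 3))).restrict S) {p} ≠ 0} \ Set.range xf =
          S \ Set.range xf := by rw [hset]
    have hdisj' : Disjoint (Set.range R) (S \ Set.range xf) := by rwa [hAS] at hdisj
    have h3 := h2.2 n xf hxf hX' k R hR hdisj'
    have ht : ∀ z : EuclideanSpace ℝ (Fin 3),
        (∑' y : ↥({p : EuclideanSpace ℝ (Fin 3) |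
            ((Measure.count : Measure (EuclideanSpace ℝ (Fin 3))).restrict S) {p} ≠ 0} \ Set.range xf),
            Literature.MathematicalPhysics.StatisticalMechanics.lennardJones (dist z (y : EuclideanSpace ℝ (Fin 3)))) =
          ∑' y : ↥(S \ Set.range xf), Literature.MathematicalPhysics.StatisticalMechanics.lennardJones
            (dist z (y : EuclideanSpace ℝ (Fin 3))) := fun z =>
      Equiv.tsum_eq (Equiv.setCongr hAS)
        (fun y : ↥(S \ Set.range xf) =>
          Literature.MathematicalPhysics.StatisticalMechanics.lennardJones (dist z (y : EuclideanSpace ℝ (Fin 3))))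
    simp only [ht]
    simpa [fieldEnergy_eq, Summit.AtomisticToContinuum.Crystallization.Theorems.MinimiserShells.Negative.LoadBearing.eStar]
      using h3

/-- The route item, by name. -/
theorem muEquilibriumDoor :
    Summit.AtomisticToContinuum.Crystallization.Theses.GrainCoreNetworkSplit.MuEquilibriumDoor := by
  unfold Summit.AtomisticToContinuum.Crystallization.Theses.GrainCoreNetworkSplit.MuEquilibriumDoor
  exact muEquilibriumDoor_holds

end Summit.AtomisticToContinuum.Crystallization.Theorems.GrainCoreNetworkSplitMuEquilibriumDoor
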